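import Literature.AlgebraicTopology.SingularHomology.LocalClassFamilies
import Literature.AlgebraicTopology.SingularHomology.LocalHomologyVanishing
import Literature.AlgebraicTopology.SingularHomology.ChartTransitionLocalDegree
import HarnessLib

/-!
# The local images of a relative class along an open Euclidean piece have a constant sign
# against any orientation of the piece (Hatcher 2002, §3.3 pp. 233–236)

Topic `Literature/AlgebraicTopology/SingularHomology`; a brick for the one-slide step of Milnor's
Basis Theorem 7.6 on a slab (`Literature.Topology.FourManifolds.Cobordism.Milnor1965_basisTheorem_slab_of_slideStep`,
`HCobordismBasisInduction.lean`; geometric half `SlideStepGeometric.lean`, whose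
`SlideSetting.exists_crossingChart` embeds an open connected piece `V ⊆ ℝᵏ` into the new
left-hand disc with open image `U`).  The sign of the crossing of the slid disc with `D_R(p₂)`
(Milnor 1965, PDF p. 52) is read at the crossing point through the localisation coefficient of the
disc's class relative to a Euclidean model; to compare two constructions one needs that this
coefficient does not depend on the point of the chart.  Hatcher, *Algebraic Topology* (2002),
§3.3 pp. 233–236: local orientations `μ_y` which are locally restrictions of one class
("locally consistent") form sections of the orientation covering, and two such sections of
generators over a connected base agree up to one global sign (Lemma 3.27, proof of Prop. 3.25).
The tree's `LocalClassFamilies.lean` has this toolkit (`relLocalFamily`,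
`consistentOn_relLocalFamily`, `LocalFamily.ConsistentOn.preimage_of_isOpenEmbedding`,
`LocalFamily.sign_eq_of_isPreconnected`); this file assembles it:

* **`exists_units_relLocalFamily_eq_smul`** — for a class `w ∈ Hₖ(T, B; ℤ)` of a Hausdorff
  space `T`, an open preconnected `U ⊆ T ∖ B` carrying the structure of a topological
  `k`-manifold (a `ChartedSpace (ℝᵏ) U` instance, e.g. from one Euclidean chart), an orientation
  `μ` of `U`, and the hypothesis that the local image of `w` at every point of `U` generates
  `Hₖ(T | u) ≅ ℤ`: there is ONE sign `ε = ±1` with `w|_u = ε • μ_u` (read in `Hₖ(T | u)` through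
  the excision `Hₖ(U | u) ≅ Hₖ(T | u)`, `localHomology.openSubsetIso`) for all `u ∈ U`.

Everything here is proved; no definitions, no named facts.

## References

* A. Hatcher, *Algebraic Topology*, CUP 2002, §3.3 pp. 233–236 (local consistency, Lemma 3.27,
  proof of Prop. 3.25), Thm. 2.20 (excision). [HatcherAT2002]
* J. Milnor, *Lectures on the h-cobordism theorem*, Princeton Mathematical Notes (1965),
  completion of the proof of Thm. 7.6 (PDF p. 52).  Held:
  `lit read book:milnornd-lectures-h-cobordism-theorem`. [MilnorHCobordism1965]
-/

noncomputable section

open CategoryTheory Set Function Filter Topology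

universe u

namespace Literature.AlgebraicTopology.SingularHomology

/-- **The local images of a relative class along an open manifold piece have a constant sign
against any orientation of the piece** (Hatcher 2002, §3.3, Lemma 3.27 / proof of Prop. 3.25,
assembled from `LocalClassFamilies.lean`).  Let `T` be Hausdorff, `B ⊆ T`, `w ∈ Hₖ(T, B; ℤ)`,
`U ⊆ T ∖ B` open and preconnected with a `ChartedSpace ℝᵏ U` structure, `μ` a `ℤ`-orientation of
`U`, and suppose the local image `w|_u ∈ Hₖ(T | u)` generates for every `u ∈ U`.  Then for one
sign `ε = ±1`: `w|_u = ε • (μ_u read in Hₖ(T | u))` for all `u ∈ U`.  Proof: pull the family of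
local images back to `U` along the open embedding `U ↪ T` (consistent near every point:
`consistentOn_relLocalFamily`, `ConsistentOn.preimage_of_isOpenEmbedding` on a compact
neighbourhood), compare with the consistent family of generators `μ`: pointwise `= ± μ_u`
(`eq_or_eq_neg_of_isGenerator`), and the sign is locally constant, hence constant
(`LocalFamily.sign_eq_of_isPreconnected`). [cite: HatcherAT2002, §3.3 pp. 233–236, Lemma 3.27; MilnorHCobordism1965, proof of Thm. 7.6 (PDF p. 52)] -/
theorem exists_units_relLocalFamily_eq_smul {k : ℕ} {T : Type u} [TopologicalSpace T] [T2Space T]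
    {B U : Set T} (hU : IsOpen U) (hUB : U ⊆ Bᶜ) (hUc : IsPreconnected U)
    [ChartedSpace (EuclideanSpace ℝ (Fin k)) ↥U]
    (w : relativeSingularHomology ℤ ℤ T B k) (μ : HomologicalOrientation ℤ ↥U k)
    (hgen : ∀ u : ↥U, ∃ e : localHomology ℤ ℤ T (u : T) k ≃ₗ[ℤ] ℤ, e (relLocalFamily w (u : T)) = 1) :
    ∃ ε : ℤˣ, ∀ u : ↥U, relLocalFamily w (u : T) =
      (ε : ℤ) • (localHomology.openSubsetIso ℤ ℤ hU u.2 k).hom (μ.localClass u) := by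
  classical
  -- the open embedding `U ↪ T` and the two families on `U`
  have hj : IsOpenEmbedding (subsetIncl U : C(↥U, T)) := hU.isOpenEmbedding_subtypeVal
  set β : LocalFamily ℤ ℤ ↥U k := fun u => μ.localClass u with hβ
  set β' : LocalFamily ℤ ℤ ↥U k := fun u =>
    (localHomology.openSubsetIso ℤ ℤ hU u.2 k).inv (relLocalFamily w (u : T)) with hβ'
  -- the maps of the toolkit are the excision isomorphism
  have hmap : ∀ u : ↥U, relativeSingularHomology.map ℤ ℤ (subsetIncl U : C(↥U, T))
      (LocalFamily.mapsTo_compl_pt hj.injective u) k = (localHomology.openSubsetIso ℤ ℤ hU u.2 k).hom :=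
    fun u => rfl
  have hββ' : ∀ u : ↥U, relLocalFamily w ((subsetIncl U : C(↥U, T)) u) =
      relativeSingularHomology.map ℤ ℤ (subsetIncl U : C(↥U, T)) (LocalFamily.mapsTo_compl_pt hj.injective u) k (β' u) := by
    intro u
    rw [hmap u]
    show relLocalFamily w (u : T) = (localHomology.openSubsetIso ℤ ℤ hU u.2 k).hom
      ((localHomology.openSubsetIso ℤ ℤ hU u.2 k).inv (relLocalFamily w (u : T)))
    rw [← ModuleCat.comp_apply, Iso.inv_hom_id, ModuleCat.id_apply]
  -- `β'` is consistent near every point: pull back along the open embedding on a compact nbhd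
  haveI : LocallyCompactSpace ↥U := ChartedSpace.locallyCompactSpace (EuclideanSpace ℝ (Fin k)) ↥U
  have hβ'cons : ∀ u : ↥U, ∃ N ∈ 𝓝 u, β'.ConsistentOn N := by
    intro u
    obtain ⟨K, hKc, hKu⟩ := exists_compact_mem_nhds u
    refine ⟨K, hKu, ?_⟩
    have himg : IsCompact ((subsetIncl U : C(↥U, T)) '' K) := hKc.image (subsetIncl U).continuous
    have hcl : closure ((subsetIncl U : C(↥U, T)) '' K) ⊆ range (subsetIncl U : C(↥U, T)) := by
      rw [himg.isClosed.closure_eq]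
      rintro _ ⟨v, -, rfl⟩
      exact ⟨v, rfl⟩
    have hKB : (subsetIncl U : C(↥U, T)) '' K ⊆ Bᶜ := by
      rintro _ ⟨v, -, rfl⟩
      exact hUB v.2
    exact LocalFamily.ConsistentOn.preimage_of_isOpenEmbedding (subsetIncl U : C(↥U, T)) hj hcl
      (consistentOn_relLocalFamily w hKB) (fun v _ => hββ' v)
  -- `β` is consistent near every point and generates
  have hβcons : ∀ u : ↥U, ∃ N ∈ 𝓝 u, β.ConsistentOn N := fun u => μ.consistentOn_nhds u
  have hβgen : ∀ u : ↥U, ∃ e : localHomology ℤ ℤ ↥U u k ≃ₗ[ℤ] ℤ, e (β u) = 1 := fun u => μ.isGenerator u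
  -- `β' u` generates too, hence `β' u = ± β u`
  have hβ'gen : ∀ u : ↥U, ∃ e : localHomology ℤ ℤ ↥U u k ≃ₗ[ℤ] ℤ, e (β' u) = 1 := fun u =>
    exists_linearEquiv_apply_eq_one_of_linearEquiv (localHomology.openSubsetIso ℤ ℤ hU u.2 k).symm.toLinearEquiv
      (hgen u)
  set ε : ↥U → ℤˣ := fun u => if β' u = β u then 1 else -1 with hεdef
  have hε : ∀ u ∈ (univ : Set ↥U), β' u = (ε u : ℤ) • β u := by
    intro u _
    by_cases h : β' u = β u
    · rw [hεdef]; simp only [h, if_true, Units.val_one, one_smul]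
    · have h' : β' u = -β u := (eq_or_eq_neg_of_isGenerator (hβ'gen u) (hβgen u)).resolve_left h
      rw [hεdef]; simp only [h, if_false, Units.val_neg, Units.val_one, neg_one_zsmul]
      exact h'
  -- the sign is constant on the preconnected `U`
  have hpre : IsPreconnected (univ : Set ↥U) := by
    haveI := isPreconnected_iff_preconnectedSpace.1 hUc
    exact isPreconnected_univ
  -- (the toolkit's `•` is the `Module ℤ` action; ours above is `zsmul`: the same map)
  have hε' : ∀ u ∈ (univ : Set ↥U), β' u =
      @HSMul.hSMul ℤ _ _ (@instHSMul ℤ _ Module.toDistribMulAction.toDistribSMul.toSMul) (ε u : ℤ) (β u) := by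
    intro u hu
    exact (hε u hu).trans (int_smul_eq_zsmul _ _ _).symm
  have hconst : ∀ u v : ↥U, ε u = ε v := fun u v =>
    LocalFamily.sign_eq_of_isPreconnected (EuclideanSpace ℝ (Fin k)) isOpen_univ hpre
      (fun x _ => hβcons x) (fun x _ => hβ'cons x) (fun x _ => hβgen x) hε' (mem_univ u) (mem_univ v)
  -- conclude
  rcases isEmpty_or_nonempty ↥U with hUe | ⟨⟨u₀⟩⟩
  · exact ⟨1, fun u => (hUe.false u).elim⟩
  refine ⟨ε u₀, fun u => ?_⟩
  have h1 : β' u = (ε u₀ : ℤ) • β u := by rw [← hconst u u₀]; exact hε u (mem_univ u)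
  calc relLocalFamily w (u : T)
      = (localHomology.openSubsetIso ℤ ℤ hU u.2 k).hom (β' u) := by
          show relLocalFamily w (u : T) = (localHomology.openSubsetIso ℤ ℤ hU u.2 k).hom
            ((localHomology.openSubsetIso ℤ ℤ hU u.2 k).inv (relLocalFamily w (u : T)))
          rw [← ModuleCat.comp_apply, Iso.inv_hom_id, ModuleCat.id_apply]
    _ = (ε u₀ : ℤ) • (localHomology.openSubsetIso ℤ ℤ hU u.2 k).hom (μ.localClass u) := by
          rw [h1, map_zsmul]

end Literature.AlgebraicTopology.SingularHomology

end
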